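import Literature.MathematicalPhysics.QuantumFieldTheory.Balaban1983to89.B9Eq326ConjugatedLocalLetters
import Literature.MathematicalPhysics.QuantumFieldTheory.Balaban1983to89.B9Eq3101ConjugationLettersCurl
import Literature.MathematicalPhysics.QuantumFieldTheory.Balaban1983to89.B9Eq3101ConjugationLettersCoCurl

/-!
# `Balaban1983to89.B9Eq326ConjugatedLocalPart` — T. Bałaban, *Propagators for lattice gauge theories in a background field*, Commun. Math. Phys. **99**
# (1985) 389–434 [Balaban1985BackgroundPropagators] (3.26) p. 395, (3.10) p. 392, (3.49) p. 399, Thm 3.11 p. 416 with [Balaban1985Variational] (134)–(136)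
# p. 298: **THE CONJUGATED INVERSE OF THE LOCAL PART — `‖e^{κχ}·A₀⁻¹·e^{−κχ}‖ ≤ 4∕γ` FOR `A₀ = Δ(U) + D_UD*_U + Q†(a•Q)`**, every background with bond
# variables in the unit balls, every cutoff `χ` with bond increments `≤ ℓη`, every `κ` in the windows — the instance of `B9Eq326ConjugatedLocalLetters` at
# the chain's carrier with the curl ∕ cocurl ∕ divergence ∕ gradient conjugation letters (`B9Eq3101ConjugationLettersCurl`, `…CoCurl`, `…Chain`)
# DISCHARGED and the `Q`, `Δ′` letters displayed; stone (D0-c) of the NE9 owner's plan v11 — the input of the Cauchy ∕ block-decay kernel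
# (`B9Eq3101CommutatorCauchyBlockDecay`) for the `L²` block decay of `A₀⁻¹`

statement-level skeleton of published theorems with citation tags; proofs where landed; nothing here is a claim about the Yang–Mills mass gap

CITATION HEADER (lean-in-tree rule).  Audit cell `pub-balaban`, sub-cell `t4`, BINDER row NE9; filed by the NE9 BINDER-row OWNER lineage
`b2b-balaban-t4-ne9-p1` (gen 92).  Imports this lineage's `B9Eq326ConjugatedLocalLetters` (abstract perturbed coercivity), `B9Eq3101ConjugationLettersCurl`
(curl + divergence letters), `B9Eq3101ConjugationLettersCoCurl` (cocurl letter); through them ne9-leaf-01's `B9Eq3101ConjugationLettersChain`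
(`norm_adTransportW_le`, the `D_U` letter) and `B9Eq310HessianOperator` (`hessOp`, `principalOpK_eq_comp`, `adjoint_covCurlL2K`, `curvOp`).  Sources READ
first-hand (`paper:balaban1985-cmp99-background-propagators`, journal page = PDF page + 388): p. 395 (3.26), p. 392 (3.10), p. 399 (3.49), p. 416 Thm 3.11;
[Balaban1985Variational] p. 298 (134)–(136).  Print's decay proof is the random walk of Sect. C; the conjugation is the ROUTE's Combes–Thomas substitute (road
B8″, as for `G′(U)` in `B9Eq349ConjugatedGreenBlockDecay`); nothing of print's rate is asserted.

WHAT IS PROVED (sorry-free; proof lane — no `def`; [folklore] composition BY NAME).  Data: periodic lattice `Pd`, normed `*`-algebra `𝔸` with fibre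
`W ≃ 𝔸` (`φ`, norming constants `M_φ`, `M_φ′`), weight `c₀`, spacing `η > 0`, background `U` with `U(b) ∈ U1` and mutually adjoint transporters `hRS`,
averaging `Q : BondL2K → F`, scalar `a ≥ 0`, trace datum `τ`, and `A₀ = hessOp φ η U τ + D_U∘D*_U + Q†∘(a•Q)` with a positivity witness `hpos₀`,
`A₀⁻¹ = greenK A₀ hpos₀`.  Multipliers (linear maps given by their pointwise action): `S`, `S⁻¹` on bonds (`e^{±κχ(b₋)}`), `S_P`, `S_P⁻¹` on plaquettes
(`e^{±κχ(p₀)}`), `S_S`, `S_S⁻¹` on sites (`e^{±κχ(x)}`).  Letters: coercivity `γ‖f‖² ≤ re⟪f, A₀f⟫` (Thm 3.11 via `B9Eq326WoodburySchur.local_coercive_of_coercive`);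
remainder floor `re⟪f, Δ′f⟫ ≥ −p_K‖f‖²`; the conjugated `Q`-letters `‖Q_κ − Q‖, ‖Q′_κ − Q†‖ ≤ β` with `S(Q†(a•Q(S⁻¹f))) = a•Q′_κ(Q_κf)`; the conjugated
`Δ′`-letter `‖SΔ′S⁻¹ − Δ′‖ ≤ β_K`; windows `‖κ‖ℓη ≤ 1`, `4‖κ‖ℓM_φM_φ′·d√d ≤ β`, `4‖κ‖ℓM_φM_φ′·d ≤ β`, `2‖κ‖ℓM_φM_φ′·√d ≤ β`, `p_K∕2 + 3(2+a)β² + β_K ≤ γ∕4`.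
* §0 pointwise-multiplier bookkeeping (`apply_inv_apply`, …), `localPart_structure` (`A₀f = B₁†(B₁f) + B₂†(B₂f) + Δ′f + a•Q†(Qf)` with `B₁ = covCurlL2K`,
  `B₂ = covDivL2K`, adjoints by `adjoint_covCurlL2K` ∕ `adjoint_covDerivL2K`), `conjLocalPart_apply` (the conjugated structure), `conjLocalPart_conjInv`.
* §1 **`norm_conjLocalInv_le`** — `‖(S ∘ A₀⁻¹ ∘ S⁻¹)v‖ ≤ (4∕γ)‖v‖`.
HONEST SCOPE.  Composition; `Q`∕`Δ′` letters, `γ`, `p_K` displayed; no circle version, no block decay yet ((D0-d)); nothing of [B9] Thm 3.1∕3.3∕3.11 asserted,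
valued or discharged; «NE9 ⇐ the named binders»; NE9 NOT PRINTED ∕ NOT PROVED; row WALLED ON A MODEL (O-NE9-1; #5 UNRULED); spine PROVED 0∕9; rung (B)+1 on
a finite T⁴ — NOT infinite volume, NOT mass gap, NOT BetaPertH, NOT Clay.  HONEST DEPENDENCY: continuum YM on T⁴ ⇐ BetaPertH ∧ nine spine estimates (0/9
proved); BetaPertH ⇐ (D1) ∧ (D4) ∧ CAP+tail.  NEW file; nothing modified.  Net new unproved facts: 0.
-/

noncomputable section

open scoped InnerProductSpace ComplexConjugate BigOperators

namespace Literature.MathematicalPhysics.QuantumFieldTheory.Balaban1983to89.B9Eq326ConjugatedLocalPart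

open B4Sect5Torus (TSite)
open B9SectCLatticeCarrier (Bond bpos btgt)
open B9Eq311L2Pairing (WL2)
open B7Prop1Explicit (U1)
open B11Eq103H1Complex (SiteL2K BondL2K greenK apply_greenK covDerivL2K covDivL2K adjoint_covDerivL2K)
open B9Eq310HessianOperator (adTransportW PlaqL2K covCurlL2K covCoCurlL2K principalOpK curvOp hessOp principalOpK_eq_comp adjoint_covCurlL2K)
open B9Eq3101ConjugationLettersChain (norm_adTransportW_le norm_mulOp_covDerivL2K_adTransportW_sub_le)
open B9Eq3101ConjugationLettersCurl (norm_mulOp_covCurlL2K_sub_le norm_mulOp_covDivL2K_sub_le)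
open B9Eq3101ConjugationLettersCoCurl (norm_mulOp_covCoCurlL2K_sub_le)
open B9Eq326ConjugatedLocalLetters (norm_Gk_le)

/-! ## §0 Pointwise multipliers: bookkeeping -/

section Multipliers

variable {X : Type*} {V : Type*} [NormedAddCommGroup V] [InnerProductSpace ℂ V] {w : X → ℝ}

/-- Two maps acting pointwise as `e^{−κχ}` and `e^{κχ}` compose to the identity. [folklore] [cite: Balaban1985BackgroundPropagators, (3.49) p.399] -/
theorem apply_inv_apply (κ : ℂ) (χ : X → ℝ) {T Tinv : WL2 ℂ w V → WL2 ℂ w V}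
    (hT : ∀ g x, WL2.equiv ℂ w V (T g) x = Complex.exp (κ * (χ x : ℂ)) • WL2.equiv ℂ w V g x)
    (hTinv : ∀ g x, WL2.equiv ℂ w V (Tinv g) x = Complex.exp (-(κ * (χ x : ℂ))) • WL2.equiv ℂ w V g x) (g : WL2 ℂ w V) :
    Tinv (T g) = g := by
  apply (WL2.equiv ℂ w V).injective
  funext x
  rw [hTinv, hT, smul_smul, ← Complex.exp_add, neg_add_cancel, Complex.exp_zero, one_smul]

/-- … and in the other order. [folklore] [cite: Balaban1985BackgroundPropagators, (3.49) p.399] -/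
theorem apply_apply_inv (κ : ℂ) (χ : X → ℝ) {T Tinv : WL2 ℂ w V → WL2 ℂ w V}
    (hT : ∀ g x, WL2.equiv ℂ w V (T g) x = Complex.exp (κ * (χ x : ℂ)) • WL2.equiv ℂ w V g x)
    (hTinv : ∀ g x, WL2.equiv ℂ w V (Tinv g) x = Complex.exp (-(κ * (χ x : ℂ))) • WL2.equiv ℂ w V g x) (g : WL2 ℂ w V) :
    T (Tinv g) = g := by
  apply (WL2.equiv ℂ w V).injective
  funext x
  rw [hT, hTinv, smul_smul, ← Complex.exp_add, add_neg_cancel, Complex.exp_zero, one_smul]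

end Multipliers

/-! ## §0′ The structure of the local part and of its conjugate -/

section Instance

variable {d : ℕ} {Pd : Fin d → ℕ} {𝔸 : Type*} [NormedRing 𝔸] [StarRing 𝔸] [NormedAlgebra ℂ 𝔸] [StarModule ℂ 𝔸] [NormOneClass 𝔸]
  {W : Type*} [NormedAddCommGroup W] [InnerProductSpace ℂ W] [FiniteDimensional ℂ W] (φ : W ≃ₗ[ℂ] 𝔸) {Mφ Mφ' : ℝ}
  (hφ : ∀ w, ‖φ w‖ ≤ Mφ * ‖w‖) (hφ' : ∀ X, ‖φ.symm X‖ ≤ Mφ' * ‖X‖) (hMφ : 0 ≤ Mφ) (hMφ' : 0 ≤ Mφ')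
  {c₀ : ℝ} [Fact (0 < c₀)] {η : ℝ} (hη : 0 < η) (U : Bond d Pd → 𝔸ˣ) (hU : ∀ b, U b ∈ U1 𝔸)
  (hRS : ∀ (b : Bond d Pd) (v u : W), ⟪adTransportW φ U b v, u⟫_ℂ = ⟪v, adTransportW φ (fun b => (U b)⁻¹) b u⟫_ℂ)
  (τ : 𝔸 →ₗ[ℂ] ℂ) {F : Type*} [NormedAddCommGroup F] [InnerProductSpace ℂ F] [FiniteDimensional ℂ F]
  (Q : BondL2K ℂ d Pd c₀ W →ₗ[ℂ] F) (a : ℝ)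

/-- `conj η⁻¹ = η⁻¹` for the real difference quotient. [folklore] [cite: Balaban1985BackgroundPropagators, (3.3) p.391] -/
theorem conj_inv_eta (η : ℝ) : (starRingEnd ℂ) ((η : ℂ))⁻¹ = ((η : ℂ))⁻¹ := by rw [map_inv₀, Complex.conj_ofReal]

omit [NormOneClass 𝔸] in
include hRS in
/-- **THE LOCAL PART IN THE SHAPE `B₁†B₁ + B₂†B₂ + K + aQ†Q`** of `B9Eq326ConjugatedLocalLetters`: with `B₁ = covCurlL2K` (curl (3.4), transporters `R(U)`),
`B₂ = covDivL2K` (divergence (3.8), transporters `R(U⁻¹)`), `K = Δ′ = curvOp`: `A₀f = B₁†(B₁f) + B₂†(B₂f) + Δ′f + a•Q†(Qf)` (`D*D = D†D` by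
`adjoint_covCurlL2K`, `DD* = (D*)†D*` by `adjoint_covDerivL2K`, for mutually adjoint transporters). [cite: Balaban1985BackgroundPropagators, (3.26) p.395, (3.10) p.392] -/
theorem localPart_structure (A₀ : BondL2K ℂ d Pd c₀ W →ₗ[ℂ] BondL2K ℂ d Pd c₀ W)
    (hA₀ : A₀ = hessOp φ η U τ + covDerivL2K ℂ c₀ ((η : ℂ))⁻¹ (adTransportW φ U) ∘ₗ covDivL2K ℂ c₀ ((η : ℂ))⁻¹ (adTransportW φ fun b => (U b)⁻¹) +
      LinearMap.adjoint Q ∘ₗ ((a : ℂ) • Q)) (f : BondL2K ℂ d Pd c₀ W) :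
    A₀ f = LinearMap.adjoint (covCurlL2K ℂ c₀ ((η : ℂ))⁻¹ (adTransportW φ U)) (covCurlL2K ℂ c₀ ((η : ℂ))⁻¹ (adTransportW φ U) f) +
      LinearMap.adjoint (covDivL2K ℂ c₀ ((η : ℂ))⁻¹ (adTransportW φ fun b => (U b)⁻¹))
        (covDivL2K ℂ c₀ ((η : ℂ))⁻¹ (adTransportW φ fun b => (U b)⁻¹) f) +
      curvOp φ τ η U f + ((a : ℝ) : ℂ) • LinearMap.adjoint Q (Q f) := by
  have h1 : LinearMap.adjoint (covCurlL2K ℂ c₀ ((η : ℂ))⁻¹ (adTransportW φ U)) =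
      covCoCurlL2K ℂ c₀ ((η : ℂ))⁻¹ (adTransportW φ fun b => (U b)⁻¹) := adjoint_covCurlL2K _ (conj_inv_eta η) _ _ hRS
  have h2 : LinearMap.adjoint (covDivL2K ℂ c₀ ((η : ℂ))⁻¹ (adTransportW φ fun b => (U b)⁻¹)) =
      covDerivL2K ℂ c₀ ((η : ℂ))⁻¹ (adTransportW φ U) := by
    rw [← adjoint_covDerivL2K ((η : ℂ))⁻¹ (conj_inv_eta η) _ _ hRS, LinearMap.adjoint_adjoint]
  rw [hA₀, h1, h2, hessOp, principalOpK_eq_comp]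
  simp only [LinearMap.add_apply, LinearMap.comp_apply, LinearMap.smul_apply, map_smul]
  abel

variable {κ : ℂ} {χ : TSite d Pd → ℝ}
  {S Sinv : BondL2K ℂ d Pd c₀ W →ₗ[ℂ] BondL2K ℂ d Pd c₀ W}
  (hS : ∀ (g : BondL2K ℂ d Pd c₀ W) (b : Bond d Pd),
    WL2.equiv ℂ (fun _ : Bond d Pd => c₀) W (S g) b = Complex.exp (κ * (χ (bpos b) : ℂ)) • WL2.equiv ℂ (fun _ : Bond d Pd => c₀) W g b)
  (hSinv : ∀ (g : BondL2K ℂ d Pd c₀ W) (b : Bond d Pd),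
    WL2.equiv ℂ (fun _ : Bond d Pd => c₀) W (Sinv g) b = Complex.exp (-(κ * (χ (bpos b) : ℂ))) • WL2.equiv ℂ (fun _ : Bond d Pd => c₀) W g b)
  {SP SPinv : PlaqL2K ℂ d Pd c₀ W →ₗ[ℂ] PlaqL2K ℂ d Pd c₀ W}
  (hSP : ∀ (g : PlaqL2K ℂ d Pd c₀ W) (p : B9SectCLatticeCarrier.Plaq d Pd),
    WL2.equiv ℂ (fun _ : B9SectCLatticeCarrier.Plaq d Pd => c₀) W (SP g) p =
      Complex.exp (κ * (χ p.1 : ℂ)) • WL2.equiv ℂ (fun _ : B9SectCLatticeCarrier.Plaq d Pd => c₀) W g p)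
  (hSPinv : ∀ (g : PlaqL2K ℂ d Pd c₀ W) (p : B9SectCLatticeCarrier.Plaq d Pd),
    WL2.equiv ℂ (fun _ : B9SectCLatticeCarrier.Plaq d Pd => c₀) W (SPinv g) p =
      Complex.exp (-(κ * (χ p.1 : ℂ))) • WL2.equiv ℂ (fun _ : B9SectCLatticeCarrier.Plaq d Pd => c₀) W g p)
  {SS SSinv : SiteL2K ℂ d Pd c₀ W →ₗ[ℂ] SiteL2K ℂ d Pd c₀ W}
  (hSS : ∀ (g : SiteL2K ℂ d Pd c₀ W) (x : TSite d Pd),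
    WL2.equiv ℂ (fun _ : TSite d Pd => c₀) W (SS g) x = Complex.exp (κ * (χ x : ℂ)) • WL2.equiv ℂ (fun _ : TSite d Pd => c₀) W g x)
  (hSSinv : ∀ (g : SiteL2K ℂ d Pd c₀ W) (x : TSite d Pd),
    WL2.equiv ℂ (fun _ : TSite d Pd => c₀) W (SSinv g) x = Complex.exp (-(κ * (χ x : ℂ))) • WL2.equiv ℂ (fun _ : TSite d Pd => c₀) W g x)

omit [NormOneClass 𝔸] in
include hRS hSP hSPinv hSS hSSinv in
/-- **THE CONJUGATED LOCAL PART HAS THE CONJUGATED STRUCTURE**: with `B_{1,κ} = S_P∘curl∘S⁻¹`, `B′_{1,κ} = S∘cocurl∘S_P⁻¹`, `B_{2,κ} = S_S∘D*∘S⁻¹`,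
`B′_{2,κ} = S∘D∘S_S⁻¹`, `K_κ = S∘Δ′∘S⁻¹` and any factorisation `S(Q†(a•Q(S⁻¹f))) = a•Q′_κ(Q_κf)`:
`(S∘A₀∘S⁻¹)f = B′_{1,κ}(B_{1,κ}f) + B′_{2,κ}(B_{2,κ}f) + K_κf + a•Q′_κ(Q_κf)` (insert `S_P⁻¹S_P = 1`, `S_S⁻¹S_S = 1`).
[cite: Balaban1985BackgroundPropagators, (3.26) p.395, (3.49) p.399] -/
theorem conjLocalPart_apply (A₀ : BondL2K ℂ d Pd c₀ W →ₗ[ℂ] BondL2K ℂ d Pd c₀ W)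
    (hA₀ : A₀ = hessOp φ η U τ + covDerivL2K ℂ c₀ ((η : ℂ))⁻¹ (adTransportW φ U) ∘ₗ covDivL2K ℂ c₀ ((η : ℂ))⁻¹ (adTransportW φ fun b => (U b)⁻¹) +
      LinearMap.adjoint Q ∘ₗ ((a : ℂ) • Q))
    (Qk : BondL2K ℂ d Pd c₀ W →ₗ[ℂ] F) (Qk' : F →ₗ[ℂ] BondL2K ℂ d Pd c₀ W)
    (hQfac : ∀ f, S (LinearMap.adjoint Q (((a : ℝ) : ℂ) • Q (Sinv f))) = ((a : ℝ) : ℂ) • Qk' (Qk f)) (f : BondL2K ℂ d Pd c₀ W) :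
    (S ∘ₗ A₀ ∘ₗ Sinv) f =
      (S ∘ₗ covCoCurlL2K ℂ c₀ ((η : ℂ))⁻¹ (adTransportW φ fun b => (U b)⁻¹) ∘ₗ SPinv)
          ((SP ∘ₗ covCurlL2K ℂ c₀ ((η : ℂ))⁻¹ (adTransportW φ U) ∘ₗ Sinv) f) +
        (S ∘ₗ covDerivL2K ℂ c₀ ((η : ℂ))⁻¹ (adTransportW φ U) ∘ₗ SSinv)
          ((SS ∘ₗ covDivL2K ℂ c₀ ((η : ℂ))⁻¹ (adTransportW φ fun b => (U b)⁻¹) ∘ₗ Sinv) f) +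
        (S ∘ₗ curvOp φ τ η U ∘ₗ Sinv) f + ((a : ℝ) : ℂ) • Qk' (Qk f) := by
  have hP : ∀ g, SPinv (SP g) = g := apply_inv_apply κ (fun p : B9SectCLatticeCarrier.Plaq d Pd => χ p.1) hSP hSPinv
  have hSi : ∀ g, SSinv (SS g) = g := apply_inv_apply κ χ hSS hSSinv
  have h1 : LinearMap.adjoint (covCurlL2K ℂ c₀ ((η : ℂ))⁻¹ (adTransportW φ U)) =
      covCoCurlL2K ℂ c₀ ((η : ℂ))⁻¹ (adTransportW φ fun b => (U b)⁻¹) := adjoint_covCurlL2K _ (conj_inv_eta η) _ _ hRS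
  have h2 : LinearMap.adjoint (covDivL2K ℂ c₀ ((η : ℂ))⁻¹ (adTransportW φ fun b => (U b)⁻¹)) =
      covDerivL2K ℂ c₀ ((η : ℂ))⁻¹ (adTransportW φ U) := by
    rw [← adjoint_covDerivL2K ((η : ℂ))⁻¹ (conj_inv_eta η) _ _ hRS, LinearMap.adjoint_adjoint]
  simp only [LinearMap.comp_apply, hP, hSi]
  rw [localPart_structure φ U hRS τ Q a A₀ hA₀ (Sinv f), h1, h2, ← hQfac]
  simp only [map_add, map_smul]

omit [StarRing 𝔸] [StarModule ℂ 𝔸] [NormOneClass 𝔸] in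
include hS hSinv in
/-- **`(S∘A₀∘S⁻¹)(S∘A₀⁻¹∘S⁻¹) = 1`** (`S⁻¹S = 1`, `SS⁻¹ = 1`, `A₀A₀⁻¹ = 1`). [cite: Balaban1985BackgroundPropagators, (3.26) p.395, Thm 3.11 p.416] -/
theorem conjLocalPart_conjInv (A₀ : BondL2K ℂ d Pd c₀ W →ₗ[ℂ] BondL2K ℂ d Pd c₀ W)
    (hpos₀ : ∀ x : BondL2K ℂ d Pd c₀ W, x ≠ 0 → 0 < RCLike.re ⟪x, A₀ x⟫_ℂ) (v : BondL2K ℂ d Pd c₀ W) :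
    (S ∘ₗ A₀ ∘ₗ Sinv) ((S ∘ₗ greenK A₀ hpos₀ ∘ₗ Sinv) v) = v := by
  simp only [LinearMap.comp_apply]
  rw [apply_inv_apply κ (fun b : Bond d Pd => χ (bpos b)) hS hSinv, apply_greenK hpos₀, apply_apply_inv κ (fun b : Bond d Pd => χ (bpos b)) hS hSinv]

/-! ## §1 `‖S A₀⁻¹ S⁻¹‖ ≤ 4∕γ` -/

include hφ hφ' hMφ hMφ' hη hU hRS hS hSinv hSP hSPinv hSS hSSinv in
/-- **THE CONJUGATED INVERSE OF THE LOCAL PART IS BOUNDED: `‖(S∘A₀⁻¹∘S⁻¹)v‖ ≤ (4∕γ)‖v‖`.**  `B9Eq326ConjugatedLocalLetters.norm_Gk_le` at the chain's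
`A₀ = Δ(U) + D_UD*_U + Q†(a•Q)` with: `γ`-coercivity of `A₀` (Thm 3.11 via `local_coercive_of_coercive`; displayed), the `Δ′` floor `re⟪f, Δ′f⟫ ≥ −p_K‖f‖²`
(displayed), the curl ∕ cocurl ∕ divergence ∕ gradient conjugation letters DISCHARGED (`B9Eq3101ConjugationLettersCurl` ∕ `…CoCurl` ∕ `…Chain` with
`M_T = M_φM_φ′` for bond variables in the unit balls) in the windows `‖κ‖ℓη ≤ 1`, `4‖κ‖ℓM_φM_φ′d√d ≤ β`, `4‖κ‖ℓM_φM_φ′d ≤ β`, `2‖κ‖ℓM_φM_φ′√d ≤ β`, the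
conjugated `Q` and `Δ′` letters displayed, and the window `p_K∕2 + 3(2+a)β² + β_K ≤ γ∕4` — every `U`, `χ`, `κ` of the letters, NO `η`, NO volume.
[cite: Balaban1985BackgroundPropagators, (3.26) p.395, (3.49) p.399, Thm 3.11 p.416; Balaban1985Variational, (134)–(136) p.298] -/
theorem norm_conjLocalInv_le (ha : 0 ≤ a)
    (A₀ : BondL2K ℂ d Pd c₀ W →ₗ[ℂ] BondL2K ℂ d Pd c₀ W)
    (hA₀ : A₀ = hessOp φ η U τ + covDerivL2K ℂ c₀ ((η : ℂ))⁻¹ (adTransportW φ U) ∘ₗ covDivL2K ℂ c₀ ((η : ℂ))⁻¹ (adTransportW φ fun b => (U b)⁻¹) +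
      LinearMap.adjoint Q ∘ₗ ((a : ℂ) • Q))
    (hpos₀ : ∀ x : BondL2K ℂ d Pd c₀ W, x ≠ 0 → 0 < RCLike.re ⟪x, A₀ x⟫_ℂ)
    {γ β βK pK ℓ : ℝ} (hγ : 0 < γ) (hβ : 0 ≤ β) (hℓ : 0 ≤ ℓ)
    (hcoer : ∀ f : BondL2K ℂ d Pd c₀ W, γ * ‖f‖ ^ 2 ≤ RCLike.re ⟪f, A₀ f⟫_ℂ)
    (hKre : ∀ f : BondL2K ℂ d Pd c₀ W, -(pK * ‖f‖ ^ 2) ≤ RCLike.re ⟪f, curvOp φ τ η U f⟫_ℂ)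
    (hχ : ∀ b : Bond d Pd, |χ (bpos b) - χ (btgt b)| ≤ ℓ * η) (hwin : ‖κ‖ * ℓ * η ≤ 1)
    (hβCC : 4 * ‖κ‖ * ℓ * (Mφ * Mφ') * (d * Real.sqrt d) ≤ β) (hβC : 4 * ‖κ‖ * ℓ * (Mφ * Mφ') * d ≤ β)
    (hβD : 2 * ‖κ‖ * ℓ * (Mφ * Mφ') * Real.sqrt d ≤ β)
    (Qk : BondL2K ℂ d Pd c₀ W →ₗ[ℂ] F) (Qk' : F →ₗ[ℂ] BondL2K ℂ d Pd c₀ W)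
    (hQfac : ∀ f, S (LinearMap.adjoint Q (((a : ℝ) : ℂ) • Q (Sinv f))) = ((a : ℝ) : ℂ) • Qk' (Qk f))
    (dQ : ∀ f, ‖Qk f - Q f‖ ≤ β * ‖f‖) (dQ' : ∀ g, ‖Qk' g - LinearMap.adjoint Q g‖ ≤ β * ‖g‖)
    (dK : ∀ f, ‖(S ∘ₗ curvOp φ τ η U ∘ₗ Sinv) f - curvOp φ τ η U f‖ ≤ βK * ‖f‖)
    (small : pK / 2 + 3 * (2 + a) * β ^ 2 + βK ≤ γ / 4) (v : BondL2K ℂ d Pd c₀ W) :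
    ‖(S ∘ₗ greenK A₀ hpos₀ ∘ₗ Sinv) v‖ ≤ 4 / γ * ‖v‖ := by
  -- transporter bounds `M_T = M_φM_φ′` for `R(U)` and `R(U⁻¹)`
  have hR : ∀ (b : Bond d Pd) (w : W), ‖adTransportW φ U b w‖ ≤ Mφ * Mφ' * ‖w‖ :=
    fun b w => norm_adTransportW_le φ hφ hφ' hMφ' U b (hU b) w
  have hSad : ∀ (b : Bond d Pd) (w : W), ‖adTransportW φ (fun b => (U b)⁻¹) b w‖ ≤ Mφ * Mφ' * ‖w‖ :=
    fun b w => norm_adTransportW_le φ hφ hφ' hMφ' (fun b => (U b)⁻¹) b ((U1 𝔸).inv_mem (hU b)) w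
  have hMT : 0 ≤ Mφ * Mφ' := mul_nonneg hMφ hMφ'
  have hθ : 0 ≤ ℓ * η := mul_nonneg hℓ hη.le
  have hwin' : ‖κ‖ * (ℓ * η) ≤ 1 := by simpa [mul_assoc] using hwin
  have hcθ : ‖((η : ℂ))⁻¹‖ * (ℓ * η) = ℓ := by
    rw [norm_inv, Complex.norm_real, Real.norm_eq_abs, abs_of_pos hη]; field_simp
  -- adjoints of the two first-order letters
  have h1 : LinearMap.adjoint (covCurlL2K ℂ c₀ ((η : ℂ))⁻¹ (adTransportW φ U)) =
      covCoCurlL2K ℂ c₀ ((η : ℂ))⁻¹ (adTransportW φ fun b => (U b)⁻¹) := adjoint_covCurlL2K _ (conj_inv_eta η) _ _ hRS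
  have h2 : LinearMap.adjoint (covDivL2K ℂ c₀ ((η : ℂ))⁻¹ (adTransportW φ fun b => (U b)⁻¹)) =
      covDerivL2K ℂ c₀ ((η : ℂ))⁻¹ (adTransportW φ U) := by
    rw [← adjoint_covDerivL2K ((η : ℂ))⁻¹ (conj_inv_eta η) _ _ hRS, LinearMap.adjoint_adjoint]
  -- the four discharged letters
  have dB₁ : ∀ f, ‖(SP ∘ₗ covCurlL2K ℂ c₀ ((η : ℂ))⁻¹ (adTransportW φ U) ∘ₗ Sinv) f - covCurlL2K ℂ c₀ ((η : ℂ))⁻¹ (adTransportW φ U) f‖ ≤ β * ‖f‖ := by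
    intro f
    have h := norm_mulOp_covCurlL2K_sub_le hθ hMT hR hχ hwin' ((η : ℂ))⁻¹ SP hSP Sinv hSinv f
    simp only [LinearMap.comp_apply]
    refine h.trans ?_
    calc 4 * ‖((η : ℂ))⁻¹‖ * ‖κ‖ * (ℓ * η) * (Mφ * Mφ') * d * ‖f‖ = 4 * ‖κ‖ * ℓ * (Mφ * Mφ') * d * ‖f‖ := by
          rw [show 4 * ‖((η : ℂ))⁻¹‖ * ‖κ‖ * (ℓ * η) = 4 * ‖κ‖ * (‖((η : ℂ))⁻¹‖ * (ℓ * η)) by ring, hcθ]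
      _ ≤ β * ‖f‖ := mul_le_mul_of_nonneg_right hβC (norm_nonneg _)
  have dB₁' : ∀ p, ‖(S ∘ₗ covCoCurlL2K ℂ c₀ ((η : ℂ))⁻¹ (adTransportW φ fun b => (U b)⁻¹) ∘ₗ SPinv) p -
      LinearMap.adjoint (covCurlL2K ℂ c₀ ((η : ℂ))⁻¹ (adTransportW φ U)) p‖ ≤ β * ‖p‖ := by
    intro p
    rw [h1]
    have h := norm_mulOp_covCoCurlL2K_sub_le hθ hMT hSad hχ hwin' ((η : ℂ))⁻¹ S hS SPinv hSPinv p
    simp only [LinearMap.comp_apply]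
    refine h.trans ?_
    calc 4 * ‖((η : ℂ))⁻¹‖ * ‖κ‖ * (ℓ * η) * (Mφ * Mφ') * (d * Real.sqrt d) * ‖p‖ = 4 * ‖κ‖ * ℓ * (Mφ * Mφ') * (d * Real.sqrt d) * ‖p‖ := by
          rw [show 4 * ‖((η : ℂ))⁻¹‖ * ‖κ‖ * (ℓ * η) = 4 * ‖κ‖ * (‖((η : ℂ))⁻¹‖ * (ℓ * η)) by ring, hcθ]
      _ ≤ β * ‖p‖ := mul_le_mul_of_nonneg_right hβCC (norm_nonneg _)
  have dB₂ : ∀ f, ‖(SS ∘ₗ covDivL2K ℂ c₀ ((η : ℂ))⁻¹ (adTransportW φ fun b => (U b)⁻¹) ∘ₗ Sinv) f -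
      covDivL2K ℂ c₀ ((η : ℂ))⁻¹ (adTransportW φ fun b => (U b)⁻¹) f‖ ≤ β * ‖f‖ := by
    intro f
    have h := norm_mulOp_covDivL2K_sub_le hθ hMT hSad hχ hwin' ((η : ℂ))⁻¹ SS hSS Sinv hSinv f
    simp only [LinearMap.comp_apply]
    refine h.trans ?_
    calc 2 * ‖((η : ℂ))⁻¹‖ * ‖κ‖ * (ℓ * η) * (Mφ * Mφ') * Real.sqrt d * ‖f‖ = 2 * ‖κ‖ * ℓ * (Mφ * Mφ') * Real.sqrt d * ‖f‖ := by
          rw [show 2 * ‖((η : ℂ))⁻¹‖ * ‖κ‖ * (ℓ * η) = 2 * ‖κ‖ * (‖((η : ℂ))⁻¹‖ * (ℓ * η)) by ring, hcθ]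
      _ ≤ β * ‖f‖ := mul_le_mul_of_nonneg_right hβD (norm_nonneg _)
  have dB₂' : ∀ s, ‖(S ∘ₗ covDerivL2K ℂ c₀ ((η : ℂ))⁻¹ (adTransportW φ U) ∘ₗ SSinv) s -
      LinearMap.adjoint (covDivL2K ℂ c₀ ((η : ℂ))⁻¹ (adTransportW φ fun b => (U b)⁻¹)) s‖ ≤ β * ‖s‖ := by
    intro s
    rw [h2]
    have h := norm_mulOp_covDerivL2K_adTransportW_sub_le φ hφ hφ' hMφ hMφ' hη hℓ U hU hχ hwin S hS SSinv hSSinv s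
    simp only [LinearMap.comp_apply]
    exact h.trans (mul_le_mul_of_nonneg_right hβD (norm_nonneg _))
  -- the structure, the conjugated structure, the inverse
  have hH := localPart_structure φ U hRS τ Q a A₀ hA₀
  have hHk := conjLocalPart_apply φ U hRS τ Q a (κ := κ) (χ := χ) (S := S) (Sinv := Sinv) hSP hSPinv hSS hSSinv A₀ hA₀ Qk Qk' hQfac
  have hHkGk := conjLocalPart_conjInv (κ := κ) (χ := χ) hS hSinv A₀ hpos₀
  exact norm_Gk_le (covCurlL2K ℂ c₀ ((η : ℂ))⁻¹ (adTransportW φ U)) (covDivL2K ℂ c₀ ((η : ℂ))⁻¹ (adTransportW φ fun b => (U b)⁻¹)) Q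
    (curvOp φ τ η U) A₀ a γ β βK pK _ _ _ _ Qk Qk' (S ∘ₗ curvOp φ τ η U ∘ₗ Sinv) (S ∘ₗ A₀ ∘ₗ Sinv) (S ∘ₗ greenK A₀ hpos₀ ∘ₗ Sinv)
    ha hγ hβ hH hcoer hKre dB₁ dB₁' dB₂ dB₂' dQ dQ' dK small hHk hHkGk v

end Instance

end Literature.MathematicalPhysics.QuantumFieldTheory.Balaban1983to89.B9Eq326ConjugatedLocalPart

end
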